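import Summits.Parity.GeneralizedHardyLittlewood.Theorems.TwinLowerDensityToGHLUniformUpperBound
import HarnessLib

/-!
# Uniform upper bound for prime-POINT COUNTS of affine systems (crux `TwinLowerDensityToGHL`, stmt-Parity-18380)

The counting form (Green–Tao's Conj. 1.4 shape) of the uniform Brun–Titchmarsh rung `uniformUpperBound`
(`Theorems/TwinLowerDensityToGHLUniformUpperBound.lean`): for `t ≥ 1`, `L` there is `C = C(t, L) > 0` with

  `#{n ∈ K ∩ [−N, N] ∩ ℤ : ψ₁(n), …, ψ_t(n) all prime} ≤ C · β_∞(Ψ, K) ∏_p β_p(Ψ) / log^t N + ε N / log^t N`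

for every `ε > 0`, all large `N`, all non-degenerate `Ψ : Fin t → AffLinForm 1` with `‖Ψ‖_N ≤ L` and all convex
`K ⊆ [−N, N]` (`uniformUpperCount`).  Proof: the LOWER half of the tree's sandwich
`vonMangoldtSum_primePointCount_sandwich` at the threshold `Y = N^{1/2}`, `a = ½ log N`: the prime points all of
whose values exceed `√N` number `g ≤ (2/log N)^t ∑_K ∏ Λ(ψᵢ n)`, the others at most `t (2√N + 1) = o(N/log^t N)`;
then `uniformUpperBound`.  The constant is `2^t` times that of `uniformUpperBound`.  This is the classical
"Brun–Titchmarsh for prime `t`-tuples" (twins / Sophie Germain / Goldbach-type pairs `≤ C 𝔖 N/log² N`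
UNIFORMLY in the shift), the upper half of Conj. 1.4 at `d = 1` up to the constant.

References: H. Halberstam, H.-E. Richert, *Sieve Methods* (1974), Thm. 2.5, §5.7 [HalberstamRichert1974];
B. Green, T. Tao, Ann. of Math. 171 (2010), Conj. 1.4 and the sketch after (1.8) [GreenTao2010].
-/

noncomputable section

open Finset Filter

namespace Summit.Parity.GeneralizedHardyLittlewood.TwinLowerDensityToGHLUniformUpperBound

open Literature.NumberTheory.Sieve

variable {t : ℕ}

/-- The count junk is `o(N / log^t N)`: `t (2 √N + 1) ≤ (ε/2) N / log^t N` for large `N`. [folklore] -/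
theorem eventually_countJunk_le (t : ℕ) {ε : ℝ} (hε : 0 < ε) :
    ∀ᶠ N : ℕ in atTop, (t : ℝ) * (2 * (N : ℝ) ^ ((1 : ℝ) / 2) + 1) ≤ ε / 2 * N / Real.log N ^ t := by
  have hmain := eventually_mul_log_pow_le_rpow t (6 * t / ε) (1 / 2) (by norm_num)
  filter_upwards [hmain, eventually_ge_atTop 16] with N hN hN16
  have hN16' : (16 : ℝ) ≤ N := by exact_mod_cast hN16
  have hNpos : (0 : ℝ) < N := by linarith
  have hN1 : (1 : ℝ) ≤ N := by linarith
  have hlogpos : 0 < Real.log N := Real.log_pos (by linarith)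
  have hlt : 0 < Real.log N ^ t := pow_pos hlogpos t
  set S : ℝ := (N : ℝ) ^ ((1 : ℝ) / 2) with hS
  have hS1 : 1 ≤ S := Real.one_le_rpow hN1 (by norm_num)
  have hSS : S * S = N := by rw [hS, ← Real.rpow_add hNpos]; norm_num
  have ht0 : (0 : ℝ) ≤ t := Nat.cast_nonneg t
  -- `6 t log^t N ≤ ε S`
  have h1 : 6 * t * Real.log N ^ t ≤ ε * S := by
    have h := mul_le_mul_of_nonneg_left hN hε.le
    have e : ε * (6 * t / ε * Real.log N ^ t) = 6 * t * Real.log N ^ t := by field_simp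
    rw [e] at h; rwa [hS]
  rw [le_div_iff₀ hlt]
  calc (t : ℝ) * (2 * S + 1) * Real.log N ^ t ≤ t * (3 * S) * Real.log N ^ t := by
        have : 2 * S + 1 ≤ 3 * S := by linarith
        have h2 : (t : ℝ) * (2 * S + 1) ≤ t * (3 * S) := mul_le_mul_of_nonneg_left this ht0
        exact mul_le_mul_of_nonneg_right h2 hlt.le
    _ = (6 * t * Real.log N ^ t) * S / 2 := by ring
    _ ≤ (ε * S) * S / 2 := by
        have hS0 : 0 ≤ S := by linarith
        have := mul_le_mul_of_nonneg_right h1 hS0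
        linarith
    _ = ε / 2 * N := by rw [mul_assoc, hSS]; ring

/-- **Uniform upper bound for prime-point counts** (Brun–Titchmarsh for prime `t`-tuples, counting form):
for `t ≥ 1`, `L` there is `C > 0` such that for every `ε > 0`, all large `N`, all non-degenerate `Ψ` with
`‖Ψ‖_N ≤ L` and all convex `K ⊆ [−N, N]`,
`#{prime points of K} ≤ C β_∞ ∏_p β_p / log^t N + ε N / log^t N`.
[cite: HalberstamRichert1974, Thm. 2.5 and §5.7] [cite: GreenTao2010, Conj. 1.4 (sketch proof)] -/
theorem uniformUpperCount (t L : ℕ) (ht : 1 ≤ t) :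
    ∃ C : ℝ, 0 < C ∧ ∀ ε : ℝ, 0 < ε → ∃ N₀ : ℕ, ∀ N : ℕ, N₀ ≤ N →
      ∀ Ψ : Fin t → AffLinForm 1, IsNondegenerateSystem Ψ → affLinSize Ψ N ≤ L →
        ∀ K : Set (Fin 1 → ℝ), Convex ℝ K → K ⊆ realBox 1 N →
          (primePointCount Ψ K N : ℝ) ≤
            C * (archFactor Ψ K * singularProduct Ψ) / Real.log N ^ t + ε * N / Real.log N ^ t := by
  obtain ⟨C, hC, hmain⟩ := uniformUpperBound t L ht
  refine ⟨2 ^ t * C, by positivity, fun ε hε => ?_⟩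
  have hε₁ : 0 < ε / 2 ^ (t + 1) := by positivity
  obtain ⟨N₁, hN₁⟩ := hmain (ε / 2 ^ (t + 1)) hε₁
  obtain ⟨N₂, hN₂⟩ := eventually_atTop.mp (eventually_countJunk_le t hε)
  refine ⟨max (max N₁ N₂) 16, fun N hN Ψ hΨ hL K hK hKN => ?_⟩
  have hNN₁ : N₁ ≤ N := le_trans (le_max_left _ _) (le_trans (le_max_left _ _) hN)
  have hNN₂ : N₂ ≤ N := le_trans (le_max_right _ _) (le_trans (le_max_left _ _) hN)
  have hN16 : (16 : ℝ) ≤ N := by exact_mod_cast le_trans (le_max_right _ _) hN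
  have hNpos : (0 : ℝ) < N := by linarith
  have hN1 : 1 ≤ N := by exact_mod_cast (show (1 : ℝ) ≤ N by linarith)
  have hN1r : (1 : ℝ) ≤ N := by linarith
  have hlogpos : 0 < Real.log N := Real.log_pos (by linarith)
  have hlt : 0 < Real.log N ^ t := pow_pos hlogpos t
  have hAF0 : 0 ≤ archFactor Ψ K := archFactor_nonneg Ψ K
  have hSP0 : 0 ≤ singularProduct Ψ :=
    ge_of_tendsto' (tendsto_singularProductPartial_holds 1 t Ψ hΨ)
      fun x => Finset.prod_nonneg fun p _ => localFactor_nonneg Ψ p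
  -- the sandwich at `Y = √N`, `a = ½ log N`
  set Y : ℝ := (N : ℝ) ^ ((1 : ℝ) / 2) with hY
  have hY1 : 1 ≤ Y := Real.one_le_rpow hN1r (by norm_num)
  have ha : 0 ≤ (1 : ℝ) / 2 * Real.log N := by positivity
  have haY : (1 : ℝ) / 2 * Real.log N ≤ Real.log Y := by
    rw [hY, Real.log_rpow hNpos]
  obtain ⟨g, β, γ, hg0, hβ0, -, hgS, -, -, hPg, hβ, -⟩ :=
    vonMangoldtSum_primePointCount_sandwich (a := (1 : ℝ) / 2 * Real.log N) (b := Real.log (2 * L * N))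
      hN1 Ψ hΨ hL K ht hY1 ha haY le_rfl
  simp only [Nat.sub_self, pow_zero, mul_one] at hβ
  have hS := hN₁ N hNN₁ Ψ hΨ hL K hK hKN
  have hjunk := hN₂ N hNN₂
  -- `g ≤ (2/log N)^t S`
  have hg : g ≤ 2 ^ t * vonMangoldtSum Ψ K N / Real.log N ^ t := by
    rw [le_div_iff₀ hlt]
    have e : ((1 : ℝ) / 2 * Real.log N) ^ t * g * 2 ^ t = g * Real.log N ^ t := by
      rw [mul_pow]
      have : ((1 : ℝ) / 2) ^ t * 2 ^ t = 1 := by rw [← mul_pow]; norm_num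
      calc ((1 : ℝ) / 2) ^ t * Real.log N ^ t * g * 2 ^ t
          = (((1 : ℝ) / 2) ^ t * 2 ^ t) * (g * Real.log N ^ t) := by ring
        _ = g * Real.log N ^ t := by rw [this, one_mul]
    have h := mul_le_mul_of_nonneg_right hgS (show (0 : ℝ) ≤ 2 ^ t by positivity)
    rw [e] at h
    linarith
  -- assemble
  have hmainS : 2 ^ t * vonMangoldtSum Ψ K N / Real.log N ^ t ≤
      2 ^ t * C * (archFactor Ψ K * singularProduct Ψ) / Real.log N ^ t + ε / 2 * N / Real.log N ^ t := by
    rw [← add_div, div_le_div_iff_of_pos_right hlt]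
    have h2 : (2 : ℝ) ^ t * (ε / 2 ^ (t + 1) * N) = ε / 2 * N := by
      rw [pow_succ]; field_simp
    calc 2 ^ t * vonMangoldtSum Ψ K N ≤ 2 ^ t * (C * (archFactor Ψ K * singularProduct Ψ) +
          ε / 2 ^ (t + 1) * N) := mul_le_mul_of_nonneg_left hS (by positivity)
      _ = 2 ^ t * C * (archFactor Ψ K * singularProduct Ψ) + ε / 2 * N := by rw [mul_add, h2]; ring
  have hβ' : β ≤ ε / 2 * N / Real.log N ^ t := hβ.trans hjunk
  have hsum : ε / 2 * N / Real.log N ^ t + ε / 2 * N / Real.log N ^ t = ε * N / Real.log N ^ t := by ring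
  linarith

end Summit.Parity.GeneralizedHardyLittlewood.TwinLowerDensityToGHLUniformUpperBound

end
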